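import Summits.Parity.GeneralizedHardyLittlewood.Theses.ZDegreeToeplitzBand
import Literature.NumberTheory.LFunctions.Zhang2022.KnifeEdgeLenZDegreeMinors

/-! POST-OPEN VARIANT of the BIRTH SKELETON (BC3) — critic ls-knife-crit-1 g3 probe: imports the opened route module
(stmt-Parity-20015 = the tree decl), drops the local def copy, closes `stub_transfer` by name (p491565).
ORIGINAL HEADER: for route `ZDegreeToeplitzBand` — statements only; sorries ONLY inside `stub_*`.
The programme SEARCHES and TYPES; no claim about Landau–Siegel zeros, Theorems 1–2 of arXiv:2211.02515 or a repaired
Margin232 until a kernel theorem says so. -/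

namespace Summit.Parity.GeneralizedHardyLittlewood.Theses.ZDegreeToeplitzBand

open Literature.NumberTheory.LFunctions.Zhang2022

-- (post-open: `PsiGradedTablesClose` is now the TREE decl of stmt-Parity-20015; local copy dropped)

/-- stub 1 · CANDIDATES THAT CLOSE (the critic's option α, = the card's K1″a + K2 content): some triple of functionals
satisfies the three ψ-graded tables for all large c′ AND its graded main-term matrix fails PSD on an in-class design — a
decidable real-analysis statement once K1 writes the formulas (X₂⁰ = the h·n = r family, F2 note §3). HARDEST; likely
product of its negation = the barrier horn `KnifeEdge.GradedPSD`. -/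
theorem stub_candidatesClose :
    ∃ c₀ : ℝ, ∃ X₁ Y₁ X₂ : KnifeEdge.PairFunctional,
      (∀ c' : ℝ, c₀ ≤ c' →
        KnifeEdge.CrossTablePsi c' 1 X₁ ∧ KnifeEdge.DualCrossTablePsi c' 1 Y₁ ∧ KnifeEdge.TauTwoTablePsi c' X₂) ∧
      KnifeEdge.GradedCloses X₁ Y₁ X₂ := by
  sorry

/-- stub 2 · TRANSFER on the (A)-recurrent horn: two triples satisfying the same tables at one c′ agree on in-class pieces
(tree `KnifeEdge.crossTablePsi_unique` / `dualCrossTablePsi_unique`, p485449), and `GradedCloses` only evaluates the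
functionals at in-class pieces, so the closing condition transfers. (Provable-now, S; kept as a named stub of the birth.) -/
theorem stub_transfer :
    ¬ Skeleton.ForAllLarge (fun D _ χ => ¬ Skeleton.AssumptionA D χ) →
      ∀ c' : ℝ, ∀ X₁ Y₁ X₂ X₁' Y₁' X₂' : KnifeEdge.PairFunctional,
        KnifeEdge.CrossTablePsi c' 1 X₁ → KnifeEdge.DualCrossTablePsi c' 1 Y₁ → KnifeEdge.TauTwoTablePsi c' X₂ →
        KnifeEdge.CrossTablePsi c' 1 X₁' → KnifeEdge.DualCrossTablePsi c' 1 Y₁' → KnifeEdge.TauTwoTablePsi c' X₂' →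
        KnifeEdge.GradedCloses X₁ Y₁ X₂ → KnifeEdge.GradedCloses X₁' Y₁' X₂' :=
  KnifeEdge.gradedCloses_transfer_all

/-- K2 from the two stubs. -/
theorem PsiGradedTablesClose_of :
    (∃ c₀ : ℝ, ∃ X₁ Y₁ X₂ : KnifeEdge.PairFunctional,
      (∀ c' : ℝ, c₀ ≤ c' →
        KnifeEdge.CrossTablePsi c' 1 X₁ ∧ KnifeEdge.DualCrossTablePsi c' 1 Y₁ ∧ KnifeEdge.TauTwoTablePsi c' X₂) ∧
      KnifeEdge.GradedCloses X₁ Y₁ X₂) →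
    (¬ Skeleton.ForAllLarge (fun D _ χ => ¬ Skeleton.AssumptionA D χ) →
      ∀ c' : ℝ, ∀ X₁ Y₁ X₂ X₁' Y₁' X₂' : KnifeEdge.PairFunctional,
        KnifeEdge.CrossTablePsi c' 1 X₁ → KnifeEdge.DualCrossTablePsi c' 1 Y₁ → KnifeEdge.TauTwoTablePsi c' X₂ →
        KnifeEdge.CrossTablePsi c' 1 X₁' → KnifeEdge.DualCrossTablePsi c' 1 Y₁' → KnifeEdge.TauTwoTablePsi c' X₂' →
        KnifeEdge.GradedCloses X₁ Y₁ X₂ → KnifeEdge.GradedCloses X₁' Y₁' X₂') →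
    PsiGradedTablesClose := by
  rintro ⟨c₀, X₁, Y₁, X₂, hT, hC⟩ htr hA
  refine ⟨c₀, fun c' hc' X₁' Y₁' X₂' t1 t21 t2 => ?_⟩
  obtain ⟨s1, s21, s2⟩ := hT c' hc'
  exact htr hA c' X₁ Y₁ X₂ X₁' Y₁' X₂' s1 s21 s2 t1 t21 t2 hC

theorem PsiGradedTablesClose_holds_of_stubs : PsiGradedTablesClose :=
  PsiGradedTablesClose_of stub_candidatesClose stub_transfer

end Summit.Parity.GeneralizedHardyLittlewood.Theses.ZDegreeToeplitzBand
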